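import Summits.QuantumFields.YangMills.Theorems.FluctuationComparisonRegPrIntLSupTailFibreOdds
import Summits.QuantumFields.YangMills.Theorems.FluctuationComparisonRegPrIntLInteriorSectionMeasurable
import Literature.MathematicalPhysics.QuantumFieldTheory.Balaban1983to89.T3DescentFibreTower
import Literature.MathematicalPhysics.QuantumFieldTheory.Balaban1983to89.T3InteriorExcision
import Literature.MathematicalPhysics.QuantumFieldTheory.Balaban1983to89.T4ExpWindowSmallField
import HarnessLib

/-!
# `FluctuationComparisonRegPrIntLSectionTubeSplit` — LINE g22-4 «persistence_geometry», row TUBE∘ `SectionTubeMassIntCan`: THE SETWISE SPLIT OF THE TUBE ROW INTO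
# TWO `K`-UNIFORM DENSITY LETTERS AT FIXED HEIGHT (Bałaban's UV stability (7)) AND ONE ONE-STEP HAAR KINEMATIC LETTER
# (crux `UnitScaleTilt.FluctuationComparisonRegPrIntL`, stmt-QuantumFields-20520; row TUBE∘ of `Cruxes/FluctuationComparisonRegPrIntL/Lines/persistence_geometry.lean`
# 970dcf79, ideator ym-r3-idea-1 g22; companion of ✓`…SectionTubeFibrewise` (the fibrewise door) and ✓`…InteriorSectionMeasurable` (GEOM∘, KRN∘ closed))

Cell `ym3-torus` (YM ladder rung R3 = continuum SU(2) Yang–Mills on T³ — a RUNG, NOT the Clay problem: not d = 4, not infinite volume, not a mass gap);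
width seat `ym-ust-20520-w3` (gen 18, LEAD-20520); helper `--supports stmt-QuantumFields-20520`.  THEOREMS ONLY (0 `def`, 0 `sorry`, default heartbeats).

WHY.  By the tower identity `D_{J,K} = D_{J,J+1} ∘ D_{J+1,K}` (lit ✓`descendTo_descendTo`) TUBE∘ at `(J, K)` is a statement about ONE measure on level-`(J+1)` fields —
`ν_K := (Gibbs_K).map D_{J+1,K}`, the run-`K` law of level `J+1` (Bałaban's effective density at height `K − J − 1` times Haar) — and the ONE-STEP map `D := D_{J,J+1}`:
`q·ν_K(D⁻¹B) ≤ ν_K(D⁻¹B ∩ T_σ)` with the `r`-link-tube `T_σ := {V | ∀ b, dist1((σ(D V) b)⁻¹·V b) < r}`.  It therefore splits SETWISE (no conditional law) into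
  ⟨UP⟩   `ν_K ≤ C_J · Haar_{J+1}` on `D⁻¹W_J(c·b₀)` — effective density bounded ABOVE over the interior window, UNIFORMLY IN `K` (the stability side of (7));
  ⟨LOW⟩  `c_J · Haar_{J+1} ≤ ν_K` on the small-field region `S_{J+1} := {PlaqSmall θ_{J+1}(b₀)}` — bounded BELOW on small fields, UNIFORMLY IN `K` (the small-field
         side of (7));
  ⟨HAAR-TUBE₁⟩ `q′·Haar_{J+1}(D⁻¹B) ≤ Haar_{J+1}(D⁻¹B ∩ T_σ)` for measurable `B ⊆ W_J(c·b₀)` — PURE ONE-STEP HAAR KINEMATICS of the averaging `ℰp` (no `K`, no Boltzmann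
         weight; [Balaban1985Averaging] Prop. 1 territory; `q′` after `F, γ, J, r, σ`);
and `q := c_J·q′∕C_J`, because the tube around a section value with margin `4r` lies inside `S_{J+1}` (lit ✓`T4ExpWindowSmallField.plaqSmall_of_bdev_le`, lit ✓`θBal_mul_le`).
* §1 ★`measurableSet_linkTube` — for a measurable centre map the tube event is measurable; ★`plaqSmall_of_linkTube` — the tube of radius `r` around a configuration with
  plaquettes `< θ − 4r` has plaquettes `< θ`; ★`linkTube_mono`.
* §2 ★★`sectionTube_setwise_of_up_low_haarTube` — GENERIC chain on ONE level: measures `ν, μ`, sets `P ⊆ S`-type hypotheses ⟹ `(c·q′∕C)·ν(P) ≤ ν(P ∩ T)`.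
* §3 ★★★`gibbsK_sectionTube_of_up_low_haarTube` — TUBE∘'s inequality at `(J, K)` from ⟨UP⟩_K, ⟨LOW⟩_K, ⟨HAAR-TUBE₁⟩ (tower identity + `Measure.map_apply`).
* §4 ★★★`sectionTubeMassIntCan_of_up_low_haarTube : ⟨UP⟩ + ⟨LOW(2θ)⟩ + ⟨HAAR-TUBE₁⟩ → TUBE∘ VERBATIM` (⟨LOW⟩ on the doubled region `{PlaqSmall 2θ_{J+1}(b₀)}`, radii reduced to
  `min r (θ_{J+1}(b₀)∕4)` by monotonicity — TUBE∘ quantifies sections WITHOUT margin).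
* §5 ★★★`oneLevelPersistenceIntCan_of_up_low_haarTube : ⟨UP⟩ + ⟨LOW on W_{J+1}(c·b₀)⟩ + ⟨HAAR-TUBE₁ for margin sections⟩ → PERS₁∘ VERBATIM`, the section being
  GEOM∘'s (✓`…InteriorSectionMeasurable.interiorSectionCan`, a theorem) — the organ-facing edition with the SMALLEST regions.
HONEST SCOPE.  Measure bookkeeping; ⟨UP⟩, ⟨LOW⟩ (Bałaban's `K`-uniform two-sided density bounds at fixed height — XL, the UV-stability content shared with the FLOOR ∕ WREG
lanes) and ⟨HAAR-TUBE₁⟩ (one-step fibre geometry of `ℰp`, M-sized, chartable) are the HYPOTHESES and are NOT proved; TUBE∘, PERS₁∘, PLAQTAIL∘, LFR♯ᶜ∘, S2β, 20520,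
`YM3TorusSU2` NOT proved; the Yang–Mills mass gap is NOT proved.
HYP-SAT (cell RULING №42).  Letters at TUBE∘'s quantifier order: `C_J, c_J` after `F, γ, J` and BEFORE `K` (that placement IS the content); `q′` after `F, γ, J, r, σ`;
satisfiable on the literal T³ families modulo exactly [Balaban1985UV3] (7) at height `K − J − 1` (⟨UP⟩∕⟨LOW⟩) and [Balaban1985Averaging] Prop. 1 (⟨HAAR-TUBE₁⟩); no
hand supplies them tonight.
References: [Balaban1985UV3] (7) p. 257, (38)–(40) p. 266; [Balaban1987RG1] (0.11) p. 253, (0.18)–(0.22) p. 255; [Balaban1985Averaging] (10) p. 19, Prop. 1 p. 22.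
-/

noncomputable section

set_option autoImplicit false

open MeasureTheory Filter Topology Set
open scoped ENNReal NNReal
open Literature.MathematicalPhysics.QuantumFieldTheory.Balaban1983to89
open Literature.MathematicalPhysics.QuantumFieldTheory.Balaban1983to89.T3ContinuumYM3Torus
open Literature.MathematicalPhysics.QuantumFieldTheory.Balaban1983to89.T3NestedUnitLaws
open Literature.MathematicalPhysics.QuantumFieldTheory.Balaban1983to89.T3UnitLawDensityEML
open Literature.MathematicalPhysics.QuantumFieldTheory.Balaban1983to89.T3UnitScaleTilt
open Literature.MathematicalPhysics.QuantumFieldTheory.Balaban1983to89.T3TiltDescent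
open Literature.MathematicalPhysics.QuantumFieldTheory.Balaban1983to89.T3DescentFibreTower
open Literature.MathematicalPhysics.QuantumFieldTheory.Balaban1983to89.T3InteriorExcision (θBal_mul_le)
open Literature.MathematicalPhysics.QuantumFieldTheory.Balaban1983to89.T3MinimiserStabilityReduction (θBal_pos)
open Literature.MathematicalPhysics.QuantumFieldTheory.Balaban1983to89.T4TiltOscillation (bdev)
open Literature.MathematicalPhysics.QuantumFieldTheory.Balaban1983to89.T4ExpWindowSmallField (plaqSmall_of_bdev_le)
open Literature.MathematicalPhysics.QuantumFieldTheory.Balaban1983to89.Missing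

namespace Summit.QuantumFields.YangMills.Theorems.FluctuationComparisonRegPrIntLSectionTubeSplit

/-! ## §1 The link-tube: measurability for a measurable centre map, and the plaquette margin -/

section Tube

variable {P P' : Params} {j j' : ℕ}

/-- ★ For a MEASURABLE centre map `W : Y → SU(2)^{bonds}` on any measurable parameter space and a measurable `π : SU(2)^{bonds} → Y`, the link-tube event
`{V | ∀ b, dist1 ((W (π V) b)⁻¹ * V b) < r}` is measurable (`SU(2)` is a `RegularGaugeGroup`: measurable `dist1`, multiplication, inversion). [folklore] -/
theorem measurableSet_linkTube {Y : Type*} [MeasurableSpace Y]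
    {W : Y → GaugeField P j (Matrix.specialUnitaryGroup (Fin 2) ℂ)} (hW : Measurable W)
    {π : GaugeField P j (Matrix.specialUnitaryGroup (Fin 2) ℂ) → Y} (hπ : Measurable π) (r : ℝ) :
    MeasurableSet {V : GaugeField P j (Matrix.specialUnitaryGroup (Fin 2) ℂ) | ∀ b : PBond P j, dist1 ((W (π V) b)⁻¹ * V b) < r} := by
  have hmeas : ∀ b : PBond P j, Measurable fun V : GaugeField P j (Matrix.specialUnitaryGroup (Fin 2) ℂ) => dist1 ((W (π V) b)⁻¹ * V b) := by
    intro b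
    have h1 : Measurable fun V : GaugeField P j (Matrix.specialUnitaryGroup (Fin 2) ℂ) => W (π V) b :=
      (measurable_pi_apply b).comp (hW.comp hπ)
    have h2 : Measurable fun V : GaugeField P j (Matrix.specialUnitaryGroup (Fin 2) ℂ) => V b := measurable_pi_apply b
    exact RegularGaugeGroup.measurable_dist1.comp (h1.inv.mul h2)
  simp only [Set.setOf_forall]
  exact MeasurableSet.iInter fun b => measurableSet_lt (hmeas b) measurable_const

/-- ★ **THE TUBE AROUND A SMALL CONFIGURATION IS SMALL**: if `W` has all plaquettes `< θ − 4r` and every bond of `V` is `r`-close to that of `W`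
(`dist1 ((W b)⁻¹ * V b) < r`), then `V` has all plaquettes `< θ` (lit ✓`plaqSmall_of_bdev_le`: the plaquette word is `4`-Lipschitz bondwise). [cite: Balaban1985Averaging, (9) p.19] -/
theorem plaqSmall_of_linkTube {θ r : ℝ} {W V : GaugeField P j (Matrix.specialUnitaryGroup (Fin 2) ℂ)}
    (hW : PlaqSmall (θ - 4 * r) W) (hV : ∀ b : PBond P j, dist1 ((W b)⁻¹ * V b) < r) : PlaqSmall θ V := by
  have h := plaqSmall_of_bdev_le (U := V) (U₀ := W) hW (τ := r) (fun b => (hV b).le)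
  simpa using h

end Tube

/-! ## §2 The generic setwise chain on one level -/

section Chain

variable {α : Type*} [MeasurableSpace α]

/-- ★★ **⟨UP⟩ + ⟨LOW⟩ + ⟨HAAR-TUBE⟩ ⟹ TUBE, ON ONE LEVEL** (generic): two measures `ν` (the law) and `μ` (the reference) on one space, a measurable «window preimage»
`PW`, a measurable small-field region `S`, a «datum preimage» `PB ⊆ PW` and a tube `T` with `PB ∩ T ⊆ S`.  If `ν ≤ C·μ` on subsets of `PW` (⟨UP⟩, as restricted measures),
`c·μ ≤ ν` on subsets of `S` (⟨LOW⟩), and `q′·μ(PB) ≤ μ(PB ∩ T)` (⟨HAAR-TUBE⟩), then `(c·q′∕C)·ν(PB) ≤ ν(PB ∩ T)` (for `0 < C`).  All inequalities are between OUTER measures, so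
no measurability of `PB`, `T` is needed beyond that of `PW` and `S`. [folklore] -/
theorem sectionTube_setwise_of_up_low_haarTube (ν μ : Measure α) {PW S PB T : Set α} (hPW : MeasurableSet PW) (hS : MeasurableSet S)
    (hBW : PB ⊆ PW) (hTS : PB ∩ T ⊆ S) {C c q' : ℝ} (hC : 0 < C) (hc : 0 ≤ c) (hq' : 0 ≤ q')
    (hup : ν.restrict PW ≤ ENNReal.ofReal C • μ.restrict PW)
    (hlow : ENNReal.ofReal c • μ.restrict S ≤ ν.restrict S)
    (htube : ENNReal.ofReal q' * μ PB ≤ μ (PB ∩ T)) :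
    ENNReal.ofReal (c * q' / C) * ν PB ≤ ν (PB ∩ T) := by
  -- ⟨UP⟩ read on `PB`
  have hup' : ν PB ≤ ENNReal.ofReal C * μ PB := by
    have h := Measure.le_iff'.mp hup PB
    rw [Measure.restrict_apply' hPW, Measure.smul_apply, Measure.restrict_apply' hPW, smul_eq_mul,
      Set.inter_eq_self_of_subset_left hBW] at h
    exact h
  -- ⟨LOW⟩ read on `PB ∩ T`
  have hlow' : ENNReal.ofReal c * μ (PB ∩ T) ≤ ν (PB ∩ T) := by
    have h := Measure.le_iff'.mp hlow (PB ∩ T)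
    rw [Measure.smul_apply, Measure.restrict_apply' hS, Measure.restrict_apply' hS, smul_eq_mul,
      Set.inter_eq_self_of_subset_left hTS] at h
    exact h
  -- the chain
  have hCne : ENNReal.ofReal C ≠ 0 := by rwa [Ne, ENNReal.ofReal_eq_zero, not_le]
  have hCtop : ENNReal.ofReal C ≠ ⊤ := ENNReal.ofReal_ne_top
  have hsplit : ENNReal.ofReal (c * q' / C) = ENNReal.ofReal c * ENNReal.ofReal q' * (ENNReal.ofReal C)⁻¹ := by
    rw [div_eq_mul_inv, ENNReal.ofReal_mul (mul_nonneg hc hq'), ENNReal.ofReal_mul hc, ENNReal.ofReal_inv_of_pos hC]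
  calc ENNReal.ofReal (c * q' / C) * ν PB
      ≤ ENNReal.ofReal (c * q' / C) * (ENNReal.ofReal C * μ PB) := mul_le_mul_right hup' _
    _ = ENNReal.ofReal c * (ENNReal.ofReal q' * μ PB) := by
        rw [hsplit, mul_assoc, mul_assoc, ← mul_assoc (ENNReal.ofReal C)⁻¹, ENNReal.inv_mul_cancel hCne hCtop, one_mul, ← mul_assoc]
    _ ≤ ENNReal.ofReal c * μ (PB ∩ T) := mul_le_mul_right htube _
    _ ≤ ν (PB ∩ T) := hlow'

end Chain

/-! ## §3 The runs: TUBE∘'s inequality at `(J, K)` from the three letters -/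

section Runs

variable (F : T3Family) {γ : ℝ} (c b₀ p₀ r : ℝ) {J K : ℕ} (hJK : J + 1 ≤ K)

/-- ★★★ **THE TUBE INEQUALITY AT `(J, K)` ⟸ ⟨UP⟩_K + ⟨LOW⟩_K + ⟨HAAR-TUBE₁⟩.**  Letters: `ν_K := (gibbsK F ℰp γ K).map (descendTo F ℰp (J+1) K hJK)` (the run-`K` law of
level `J+1`), `Haar := fieldMeasure (F.P (J+1)) 0 SU(2)`, `D := descendTo F ℰp J (J+1)`, window `W := {PlaqSmall θ_J(c·b₀)}`, a small-field threshold `θS` and a MEASURABLE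
centre map `σ` whose values on `W` have plaquettes `< θS − 4r`.  Hypotheses: ⟨UP⟩ `ν_K⌊D⁻¹W ≤ ofReal C · Haar⌊D⁻¹W`, ⟨LOW⟩ `ofReal cl · Haar⌊{PlaqSmall θS} ≤ ν_K⌊{PlaqSmall θS}`,
⟨HAAR-TUBE₁⟩ `ofReal q′·Haar(D⁻¹B) ≤ Haar(D⁻¹B ∩ T_σ)` for the given measurable `B ⊆ W`.  Conclusion: TUBE∘'s sentence at `(J, K)` for this `σ, r, B` with `q := cl·q′∕C`
(tower identity ✓`descendTo_descendTo`, `Measure.map_apply`, §1, §2). [cite: Balaban1985UV3, (7) p.257 and (38)-(40) p.266; Balaban1987RG1, (0.11) p.253; Balaban1985Averaging, Prop. 1 p.22] -/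
theorem gibbsK_sectionTube_of_up_low_haarTube
    {σ : GaugeField (F.P J) 0 (Matrix.specialUnitaryGroup (Fin 2) ℂ) → GaugeField (F.P (J + 1)) 0 (Matrix.specialUnitaryGroup (Fin 2) ℂ)} (hσm : Measurable σ)
    {θS : ℝ} (hσ : ∀ U : GaugeField (F.P J) 0 (Matrix.specialUnitaryGroup (Fin 2) ℂ), PlaqSmall (θBal F.L γ (c * b₀) p₀ J) U → PlaqSmall (θS - 4 * r) (σ U))
    {C cl q' : ℝ} (hC : 0 < C) (hcl : 0 ≤ cl) (hq' : 0 ≤ q')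
    (hup : ((gibbsK F ℰp γ K).map (descendTo F ℰp (J + 1) K hJK)).restrict
        (descendTo F ℰp J (J + 1) (Nat.le_succ J) ⁻¹' {U | PlaqSmall (θBal F.L γ (c * b₀) p₀ J) U}) ≤
      ENNReal.ofReal C • (fieldMeasure (F.P (J + 1)) 0 (Matrix.specialUnitaryGroup (Fin 2) ℂ)).restrict
        (descendTo F ℰp J (J + 1) (Nat.le_succ J) ⁻¹' {U | PlaqSmall (θBal F.L γ (c * b₀) p₀ J) U}))
    (hlow : ENNReal.ofReal cl • (fieldMeasure (F.P (J + 1)) 0 (Matrix.specialUnitaryGroup (Fin 2) ℂ)).restrict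
        {V | PlaqSmall θS V} ≤
      ((gibbsK F ℰp γ K).map (descendTo F ℰp (J + 1) K hJK)).restrict {V | PlaqSmall θS V})
    {B : Set (GaugeField (F.P J) 0 (Matrix.specialUnitaryGroup (Fin 2) ℂ))} (hB : MeasurableSet B)
    (hBW : B ⊆ {U | PlaqSmall (θBal F.L γ (c * b₀) p₀ J) U})
    (htube : ENNReal.ofReal q' * fieldMeasure (F.P (J + 1)) 0 (Matrix.specialUnitaryGroup (Fin 2) ℂ) (descendTo F ℰp J (J + 1) (Nat.le_succ J) ⁻¹' B) ≤
      fieldMeasure (F.P (J + 1)) 0 (Matrix.specialUnitaryGroup (Fin 2) ℂ) (descendTo F ℰp J (J + 1) (Nat.le_succ J) ⁻¹' B ∩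
        {V | ∀ b : PBond (F.P (J + 1)) 0, dist1 ((σ (descendTo F ℰp J (J + 1) (Nat.le_succ J) V) b)⁻¹ * V b) < r})) :
    ENNReal.ofReal (cl * q' / C) * gibbsK F ℰp γ K (descendTo F ℰp J K ((Nat.le_succ J).trans hJK) ⁻¹' B) ≤
      gibbsK F ℰp γ K (descendTo F ℰp J K ((Nat.le_succ J).trans hJK) ⁻¹' B ∩
        {V | ∀ b : PBond (F.P (J + 1)) 0,
          dist1 ((σ (descendTo F ℰp J K ((Nat.le_succ J).trans hJK) V) b)⁻¹ * descendTo F ℰp (J + 1) K hJK V b) < r}) := by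
  -- measurability
  have hD : Measurable (descendTo F ℰp J (J + 1) (Nat.le_succ J)) := measurable_descendTo F ℰp measurableE_ℰp _
  have hD' : Measurable (descendTo F ℰp (J + 1) K hJK) := measurable_descendTo F ℰp measurableE_ℰp _
  have hW : MeasurableSet {U : GaugeField (F.P J) 0 (Matrix.specialUnitaryGroup (Fin 2) ℂ) | PlaqSmall (θBal F.L γ (c * b₀) p₀ J) U} :=
    measurableSet_plaqSmall _
  have hS : MeasurableSet {V : GaugeField (F.P (J + 1)) 0 (Matrix.specialUnitaryGroup (Fin 2) ℂ) | PlaqSmall θS V} := measurableSet_plaqSmall _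
  have hT : MeasurableSet {V : GaugeField (F.P (J + 1)) 0 (Matrix.specialUnitaryGroup (Fin 2) ℂ) |
      ∀ b : PBond (F.P (J + 1)) 0, dist1 ((σ (descendTo F ℰp J (J + 1) (Nat.le_succ J) V) b)⁻¹ * V b) < r} :=
    measurableSet_linkTube hσm hD r
  -- the tube around a section value is small: `D⁻¹B ∩ T ⊆ S`
  have hTS : descendTo F ℰp J (J + 1) (Nat.le_succ J) ⁻¹' B ∩
      {V | ∀ b : PBond (F.P (J + 1)) 0, dist1 ((σ (descendTo F ℰp J (J + 1) (Nat.le_succ J) V) b)⁻¹ * V b) < r} ⊆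
      {V | PlaqSmall θS V} := by
    rintro V ⟨hVB, hVT⟩
    exact plaqSmall_of_linkTube (hσ _ (hBW hVB)) hVT
  -- the one-level chain
  have hchain := sectionTube_setwise_of_up_low_haarTube ((gibbsK F ℰp γ K).map (descendTo F ℰp (J + 1) K hJK))
    (fieldMeasure (F.P (J + 1)) 0 (Matrix.specialUnitaryGroup (Fin 2) ℂ)) (hD hW) hS (Set.preimage_mono hBW) hTS hC hcl hq' hup hlow htube
  -- back to run `K` through the tower identity
  have hpre : descendTo F ℰp J K ((Nat.le_succ J).trans hJK) ⁻¹' B =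
      descendTo F ℰp (J + 1) K hJK ⁻¹' (descendTo F ℰp J (J + 1) (Nat.le_succ J) ⁻¹' B) := by
    ext V
    simp only [Set.mem_preimage, descendTo_descendTo]
  have hpreT : descendTo F ℰp J K ((Nat.le_succ J).trans hJK) ⁻¹' B ∩
      {V | ∀ b : PBond (F.P (J + 1)) 0,
        dist1 ((σ (descendTo F ℰp J K ((Nat.le_succ J).trans hJK) V) b)⁻¹ * descendTo F ℰp (J + 1) K hJK V b) < r} =
      descendTo F ℰp (J + 1) K hJK ⁻¹' (descendTo F ℰp J (J + 1) (Nat.le_succ J) ⁻¹' B ∩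
        {V | ∀ b : PBond (F.P (J + 1)) 0, dist1 ((σ (descendTo F ℰp J (J + 1) (Nat.le_succ J) V) b)⁻¹ * V b) < r}) := by
    ext V
    simp only [Set.mem_inter_iff, Set.mem_preimage, Set.mem_setOf_eq, descendTo_descendTo]
  have e1 : gibbsK F ℰp γ K (descendTo F ℰp J K ((Nat.le_succ J).trans hJK) ⁻¹' B) =
      gibbsK F ℰp γ K (descendTo F ℰp (J + 1) K hJK ⁻¹' (descendTo F ℰp J (J + 1) (Nat.le_succ J) ⁻¹' B)) := congrArg _ hpre
  have e2 := congrArg (gibbsK F ℰp γ K) hpreT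
  rw [e1, e2]
  rwa [Measure.map_apply hD' (hD hB), Measure.map_apply hD' ((hD hB).inter hT)] at hchain

/-- The link-tube is monotone in its radius (any parameter space `X`, centre map `W ∘ π`, read-out `ρ`). [folklore] -/
theorem linkTube_mono {X Y : Type*} {P : Params} {j : ℕ} (W : Y → GaugeField P j (Matrix.specialUnitaryGroup (Fin 2) ℂ))
    (π : X → Y) (ρ : X → GaugeField P j (Matrix.specialUnitaryGroup (Fin 2) ℂ)) {r r' : ℝ} (h : r' ≤ r) :
    {V : X | ∀ b : PBond P j, dist1 ((W (π V) b)⁻¹ * ρ V b) < r'} ⊆ {V : X | ∀ b : PBond P j, dist1 ((W (π V) b)⁻¹ * ρ V b) < r} :=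
  fun _ hV b => (hV b).trans_le h

end Runs

/-! ## §4 The knit: ⟨UP⟩ + ⟨LOW⟩ + ⟨HAAR-TUBE₁⟩ ⇒ TUBE∘ verbatim -/

section Knit

/-- ★★★ **⟨UP⟩ + ⟨LOW⟩ + ⟨HAAR-TUBE₁⟩ ⇒ TUBE∘ `SectionTubeMassIntCan` VERBATIM** (LINE g22-4 `persistence_geometry.lean` 970dcf79 ll.137–158).  Hypotheses, in TUBE∘'s
prefix: after `F, γ`, for every window level `J` — ⟨UP⟩∕⟨LOW⟩: constants `C > 0`, `cl > 0` such that FOR EVERY RUN `K ≥ J+1` the run-`K` law of level `J+1`,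
`ν_K = (Gibbs_K).map D_{J+1,K}`, satisfies `ν_K⌊D⁻¹W_J(c·b₀) ≤ C·Haar⌊D⁻¹W_J(c·b₀)` and `cl·Haar⌊S⁺ ≤ ν_K⌊S⁺` on the DOUBLED small-field region `S⁺ = {PlaqSmall (2·θ_{J+1}(b₀))}`
(doubled because TUBE∘ quantifies every admissible `σ` WITHOUT margin, so an `r`-tube may leave `S_{J+1}(b₀)`; every radius is reduced to `r′ = min r (θ_{J+1}(b₀)∕4)` by
monotonicity of the tube) — the `K`-UNIFORM two-sided density bounds at fixed height, [Balaban1985UV3] (7); ⟨HAAR-TUBE₁⟩: for every `r > 0` and every measurable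
admissible `σ`, a `q′ > 0` with `q′·Haar(D⁻¹B) ≤ Haar(D⁻¹B ∩ T_σ)` for every measurable `B ⊆ W_J(c·b₀)` — the one-step Haar kinematics of `ℰp`.  Conclusion: TUBE∘ byte for
byte.  HONEST SCOPE: a door; none of the three letters is proved. [cite: Balaban1985UV3, (7) p.257 and (38)-(40) p.266; Balaban1987RG1, (0.18)-(0.22) p.255; Balaban1985Averaging, Prop. 1 p.22] -/
theorem sectionTubeMassIntCan_of_up_low_haarTube
    (h : ∀ (L : ℕ), ∃ c₀ : ℝ, 0 < c₀ ∧ c₀ ≤ 1 ∧ ∀ (c : ℝ), 0 < c → c ≤ c₀ → ∃ pS : ℝ, ∀ (b₀ p₀ : ℝ), 0 < b₀ → pS ≤ p₀ → 0 < p₀ →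
      ∃ γ₁ : ℝ, 0 < γ₁ ∧ γ₁ ≤ 1 ∧ ∀ (F : T3Family) (γ : ℝ), F.L = L → 0 < γ → γ ≤ γ₁ →
        ∀ (J : ℕ),
          (∃ C cl : ℝ, 0 < C ∧ 0 < cl ∧ ∀ (K : ℕ) (hJK : J + 1 ≤ K),
            ((gibbsK F ℰp γ K).map (descendTo F ℰp (J + 1) K hJK)).restrict
                (descendTo F ℰp J (J + 1) (Nat.le_succ J) ⁻¹' {U | PlaqSmall (θBal F.L γ (c * b₀) p₀ J) U}) ≤
              ENNReal.ofReal C • (fieldMeasure (F.P (J + 1)) 0 (Matrix.specialUnitaryGroup (Fin 2) ℂ)).restrict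
                (descendTo F ℰp J (J + 1) (Nat.le_succ J) ⁻¹' {U | PlaqSmall (θBal F.L γ (c * b₀) p₀ J) U}) ∧
            ENNReal.ofReal cl • (fieldMeasure (F.P (J + 1)) 0 (Matrix.specialUnitaryGroup (Fin 2) ℂ)).restrict
                {V | PlaqSmall (2 * θBal F.L γ b₀ p₀ (J + 1)) V} ≤
              ((gibbsK F ℰp γ K).map (descendTo F ℰp (J + 1) K hJK)).restrict {V | PlaqSmall (2 * θBal F.L γ b₀ p₀ (J + 1)) V}) ∧
          (∀ (r : ℝ), 0 < r →
            ∀ σ : GaugeField (F.P J) 0 (Matrix.specialUnitaryGroup (Fin 2) ℂ) → GaugeField (F.P (J + 1)) 0 (Matrix.specialUnitaryGroup (Fin 2) ℂ), Measurable σ →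
              (∀ U : GaugeField (F.P J) 0 (Matrix.specialUnitaryGroup (Fin 2) ℂ), PlaqSmall (θBal F.L γ (c * b₀) p₀ J) U →
                descendTo F ℰp J (J + 1) (Nat.le_succ J) (σ U) = U ∧ PlaqSmall (θBal F.L γ b₀ p₀ (J + 1)) (σ U)) →
              ∃ q' : ℝ, 0 < q' ∧ ∀ (B : Set (GaugeField (F.P J) 0 (Matrix.specialUnitaryGroup (Fin 2) ℂ))), MeasurableSet B →
                B ⊆ {U | PlaqSmall (θBal F.L γ (c * b₀) p₀ J) U} →
                ENNReal.ofReal q' * fieldMeasure (F.P (J + 1)) 0 (Matrix.specialUnitaryGroup (Fin 2) ℂ) (descendTo F ℰp J (J + 1) (Nat.le_succ J) ⁻¹' B) ≤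
                  fieldMeasure (F.P (J + 1)) 0 (Matrix.specialUnitaryGroup (Fin 2) ℂ) (descendTo F ℰp J (J + 1) (Nat.le_succ J) ⁻¹' B ∩
                    {V | ∀ b : PBond (F.P (J + 1)) 0, dist1 ((σ (descendTo F ℰp J (J + 1) (Nat.le_succ J) V) b)⁻¹ * V b) < r}))) :
    ∀ (L : ℕ), ∃ c₀ : ℝ, 0 < c₀ ∧ c₀ ≤ 1 ∧ ∀ (c : ℝ), 0 < c → c ≤ c₀ → ∃ pS : ℝ, ∀ (b₀ p₀ : ℝ), 0 < b₀ → pS ≤ p₀ → 0 < p₀ →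
      ∃ γ₁ : ℝ, 0 < γ₁ ∧ ∀ (F : T3Family) (γ : ℝ), F.L = L → 0 < γ → γ ≤ γ₁ →
        ∀ (J : ℕ) (r : ℝ), 0 < r →
          ∀ σ : GaugeField (F.P J) 0 (Matrix.specialUnitaryGroup (Fin 2) ℂ) → GaugeField (F.P (J + 1)) 0 (Matrix.specialUnitaryGroup (Fin 2) ℂ), Measurable σ →
            (∀ U : GaugeField (F.P J) 0 (Matrix.specialUnitaryGroup (Fin 2) ℂ), PlaqSmall (θBal F.L γ (c * b₀) p₀ J) U →
              descendTo F ℰp J (J + 1) (Nat.le_succ J) (σ U) = U ∧ PlaqSmall (θBal F.L γ b₀ p₀ (J + 1)) (σ U)) →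
            ∃ q : ℝ, 0 < q ∧ ∀ (K : ℕ) (hJK : J + 1 ≤ K)
              (B : Set (GaugeField (F.P J) 0 (Matrix.specialUnitaryGroup (Fin 2) ℂ))), MeasurableSet B →
                B ⊆ {U | PlaqSmall (θBal F.L γ (c * b₀) p₀ J) U} →
                ENNReal.ofReal q * gibbsK F ℰp γ K (descendTo F ℰp J K ((Nat.le_succ J).trans hJK) ⁻¹' B) ≤
                  gibbsK F ℰp γ K (descendTo F ℰp J K ((Nat.le_succ J).trans hJK) ⁻¹' B ∩
                    {V | ∀ b : PBond (F.P (J + 1)) 0,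
                      dist1 ((σ (descendTo F ℰp J K ((Nat.le_succ J).trans hJK) V) b)⁻¹ *
                        descendTo F ℰp (J + 1) K hJK V b) < r}) := by
  intro L
  obtain ⟨c₀, hc₀, hc₀1, hc⟩ := h L
  refine ⟨c₀, hc₀, hc₀1, fun c hcpos hcle => ?_⟩
  obtain ⟨pS, hpS⟩ := hc c hcpos hcle
  refine ⟨pS, fun b₀ p₀ hb₀ hpS' hp₀ => ?_⟩
  obtain ⟨γ₁, hγ₁, hγ₁1, hγ₁F⟩ := hpS b₀ p₀ hb₀ hpS' hp₀
  refine ⟨γ₁, hγ₁, fun F γ hFL hγ hγle J r hr σ hσm hadm => ?_⟩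
  have hγ1 : γ ≤ 1 := hγle.trans hγ₁1
  have hL1 : 1 ≤ F.L := F.hL.2.le
  obtain ⟨⟨C, cl, hC, hcl, hUL⟩, hHT⟩ := hγ₁F F γ hFL hγ hγle J
  -- reduce the radius: `r′ := min r (θ_{J+1}(b₀)/4)`
  have hθ : 0 < θBal F.L γ b₀ p₀ (J + 1) := θBal_pos hL1 hγ hγ1 hb₀ p₀ (J + 1)
  set r' : ℝ := min r (θBal F.L γ b₀ p₀ (J + 1) / 4) with hr'_def
  have hr' : 0 < r' := lt_min hr (by positivity)
  have hr'le : r' ≤ r := min_le_left _ _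
  have hr'θ : 4 * r' ≤ θBal F.L γ b₀ p₀ (J + 1) := by
    have := min_le_right r (θBal F.L γ b₀ p₀ (J + 1) / 4)
    linarith
  obtain ⟨q', hq', hHTB⟩ := hHT r' hr' σ hσm hadm
  refine ⟨cl * q' / C, by positivity, fun K hJK B hB hBW => ?_⟩
  obtain ⟨hup, hlow⟩ := hUL K hJK
  -- the admissible section's values are `(2θ − 4r′)`-small
  have hσ : ∀ U : GaugeField (F.P J) 0 (Matrix.specialUnitaryGroup (Fin 2) ℂ), PlaqSmall (θBal F.L γ (c * b₀) p₀ J) U →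
      PlaqSmall (2 * θBal F.L γ b₀ p₀ (J + 1) - 4 * r') (σ U) :=
    fun U hU p => ((hadm U hU).2 p).trans_le (by linarith)
  refine (gibbsK_sectionTube_of_up_low_haarTube F c b₀ p₀ r' hJK hσm hσ hC hcl.le hq'.le hup hlow hB hBW (hHTB B hB hBW)).trans
    (measure_mono (Set.inter_subset_inter_right _ ?_))
  exact linkTube_mono σ (descendTo F ℰp J K ((Nat.le_succ J).trans hJK)) (descendTo F ℰp (J + 1) K hJK) hr'le

end Knit

/-! ## §5 The organ-facing knit: ⟨UP⟩ + ⟨LOW on the INTERIOR window of level J+1⟩ + ⟨HAAR-TUBE₁ for ONE section⟩ ⇒ PERS₁∘ verbatim, GEOM∘ supplied by ✓`interiorSectionCan` -/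

section Pers

/-- ★★★ **PERS₁∘ `OneLevelPersistenceIntCan` VERBATIM ⟸ ⟨UP⟩ + ⟨LOW on `W_{J+1}(c·b₀)`⟩ + ⟨HAAR-TUBE₁⟩, WITH GEOM∘ DISCHARGED** (LINE g22-4 `persistence_geometry.lean` 970dcf79
ll.93–104 = LINE g22-2 `persistence_floor.lean` §2): here ⟨LOW⟩ is asked only on the level-`(J+1)` INTERIOR window `{PlaqSmall θ_{J+1}(c·b₀)}` — the smallest region on which
Bałaban's (7) is needed — because the section is GEOM∘'s (✓`…InteriorSectionMeasurable.interiorSectionCan`, a theorem): its margin `4r` keeps the `r`-tube inside that window,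
and ⟨HAAR-TUBE₁⟩ is asked for every measurable section WITH that margin (the hand may of course prove it for all admissible ones).  Proof: GEOM∘ gives `r, σ`; §3 at
`θS := θ_{J+1}(c·b₀)`; the tube inside `D_{J,K}⁻¹B` lies in `D_{J+1,K}⁻¹W_{J+1}(c·b₀)` (§1), monotonicity of `Gibbs_K`.  HONEST SCOPE: a door; ⟨UP⟩, ⟨LOW⟩, ⟨HAAR-TUBE₁⟩ NOT
proved; PERS₁∘ NOT proved. [cite: Balaban1985UV3, (7) p.257 and (38)-(40) p.266; Balaban1987RG1, (0.18)-(0.22) p.255; Balaban1985Averaging, Prop. 1 p.22] -/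
theorem oneLevelPersistenceIntCan_of_up_low_haarTube
    (h : ∀ (L : ℕ), ∃ c₀ : ℝ, 0 < c₀ ∧ c₀ ≤ 1 ∧ ∀ (c : ℝ), 0 < c → c ≤ c₀ → ∃ pS : ℝ, ∀ (b₀ p₀ : ℝ), 0 < b₀ → pS ≤ p₀ → 0 < p₀ →
      ∃ γ₁ : ℝ, 0 < γ₁ ∧ ∀ (F : T3Family) (γ : ℝ), F.L = L → 0 < γ → γ ≤ γ₁ →
        ∀ (J : ℕ),
          (∃ C cl : ℝ, 0 < C ∧ 0 < cl ∧ ∀ (K : ℕ) (hJK : J + 1 ≤ K),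
            ((gibbsK F ℰp γ K).map (descendTo F ℰp (J + 1) K hJK)).restrict
                (descendTo F ℰp J (J + 1) (Nat.le_succ J) ⁻¹' {U | PlaqSmall (θBal F.L γ (c * b₀) p₀ J) U}) ≤
              ENNReal.ofReal C • (fieldMeasure (F.P (J + 1)) 0 (Matrix.specialUnitaryGroup (Fin 2) ℂ)).restrict
                (descendTo F ℰp J (J + 1) (Nat.le_succ J) ⁻¹' {U | PlaqSmall (θBal F.L γ (c * b₀) p₀ J) U}) ∧
            ENNReal.ofReal cl • (fieldMeasure (F.P (J + 1)) 0 (Matrix.specialUnitaryGroup (Fin 2) ℂ)).restrict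
                {V | PlaqSmall (θBal F.L γ (c * b₀) p₀ (J + 1)) V} ≤
              ((gibbsK F ℰp γ K).map (descendTo F ℰp (J + 1) K hJK)).restrict {V | PlaqSmall (θBal F.L γ (c * b₀) p₀ (J + 1)) V}) ∧
          (∀ (r : ℝ), 0 < r →
            ∀ σ : GaugeField (F.P J) 0 (Matrix.specialUnitaryGroup (Fin 2) ℂ) → GaugeField (F.P (J + 1)) 0 (Matrix.specialUnitaryGroup (Fin 2) ℂ), Measurable σ →
              (∀ U : GaugeField (F.P J) 0 (Matrix.specialUnitaryGroup (Fin 2) ℂ), PlaqSmall (θBal F.L γ (c * b₀) p₀ J) U →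
                descendTo F ℰp J (J + 1) (Nat.le_succ J) (σ U) = U ∧ PlaqSmall (θBal F.L γ (c * b₀) p₀ (J + 1) - 4 * r) (σ U)) →
              ∃ q' : ℝ, 0 < q' ∧ ∀ (B : Set (GaugeField (F.P J) 0 (Matrix.specialUnitaryGroup (Fin 2) ℂ))), MeasurableSet B →
                B ⊆ {U | PlaqSmall (θBal F.L γ (c * b₀) p₀ J) U} →
                ENNReal.ofReal q' * fieldMeasure (F.P (J + 1)) 0 (Matrix.specialUnitaryGroup (Fin 2) ℂ) (descendTo F ℰp J (J + 1) (Nat.le_succ J) ⁻¹' B) ≤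
                  fieldMeasure (F.P (J + 1)) 0 (Matrix.specialUnitaryGroup (Fin 2) ℂ) (descendTo F ℰp J (J + 1) (Nat.le_succ J) ⁻¹' B ∩
                    {V | ∀ b : PBond (F.P (J + 1)) 0, dist1 ((σ (descendTo F ℰp J (J + 1) (Nat.le_succ J) V) b)⁻¹ * V b) < r}))) :
    ∀ (L : ℕ), ∃ c₀ : ℝ, 0 < c₀ ∧ c₀ ≤ 1 ∧ ∀ (c : ℝ), 0 < c → c ≤ c₀ → ∃ pS : ℝ, ∀ (b₀ p₀ : ℝ), 0 < b₀ → pS ≤ p₀ → 0 < p₀ →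
      ∃ γ₁ : ℝ, 0 < γ₁ ∧ ∀ (F : T3Family) (γ : ℝ), F.L = L → 0 < γ → γ ≤ γ₁ →
        ∀ (J : ℕ), ∃ q : ℝ, 0 < q ∧ ∀ (K : ℕ) (hJK : J + 1 ≤ K)
          (B : Set (GaugeField (F.P J) 0 (Matrix.specialUnitaryGroup (Fin 2) ℂ))), MeasurableSet B →
            B ⊆ {U | PlaqSmall (θBal F.L γ (c * b₀) p₀ J) U} →
            ENNReal.ofReal q * gibbsK F ℰp γ K (descendTo F ℰp J K ((Nat.le_succ J).trans hJK) ⁻¹' B) ≤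
              gibbsK F ℰp γ K (descendTo F ℰp J K ((Nat.le_succ J).trans hJK) ⁻¹' B ∩
                descendTo F ℰp (J + 1) K hJK ⁻¹' {V | PlaqSmall (θBal F.L γ (c * b₀) p₀ (J + 1)) V}) := by
  intro L
  obtain ⟨c₁, hc₁, hc₁1, H1⟩ := Summit.QuantumFields.YangMills.Theorems.FluctuationComparisonRegPrIntLInteriorSectionMeasurable.interiorSectionCan L
  obtain ⟨c₂, hc₂, -, H2⟩ := h L
  refine ⟨min c₁ c₂, lt_min hc₁ hc₂, (min_le_left _ _).trans hc₁1, fun c hc hcle => ?_⟩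
  obtain ⟨pS₁, H1⟩ := H1 c hc (hcle.trans (min_le_left _ _))
  obtain ⟨pS₂, H2⟩ := H2 c hc (hcle.trans (min_le_right _ _))
  refine ⟨max pS₁ pS₂, fun b₀ p₀ hb hpS hp => ?_⟩
  obtain ⟨γ₁, hγ₁, H1⟩ := H1 b₀ p₀ hb ((le_max_left _ _).trans hpS) hp
  obtain ⟨γ₂, hγ₂, H2⟩ := H2 b₀ p₀ hb ((le_max_right _ _).trans hpS) hp
  refine ⟨min γ₁ γ₂, lt_min hγ₁ hγ₂, fun F γ hFL hγ hγle J => ?_⟩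
  obtain ⟨r, hr, σ, hσm, hσ⟩ := H1 F γ hFL hγ (hγle.trans (min_le_left _ _)) J
  obtain ⟨⟨C, cl, hC, hcl, hUL⟩, hHT⟩ := H2 F γ hFL hγ (hγle.trans (min_le_right _ _)) J
  obtain ⟨q', hq', hHTB⟩ := hHT r hr σ hσm hσ
  refine ⟨cl * q' / C, by positivity, fun K hJK B hB hBW => ?_⟩
  obtain ⟨hup, hlow⟩ := hUL K hJK
  refine (gibbsK_sectionTube_of_up_low_haarTube F c b₀ p₀ r hJK hσm (fun U hU => (hσ U hU).2) hC hcl.le hq'.le hup hlow hB hBW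
    (hHTB B hB hBW)).trans (measure_mono ?_)
  rintro V ⟨hVB, hVt⟩
  refine ⟨hVB, ?_⟩
  -- the datum is interior, the section has the margin, the tube transfers it (through the tower identity)
  have hU : PlaqSmall (θBal F.L γ (c * b₀) p₀ J) (descendTo F ℰp J K ((Nat.le_succ J).trans hJK) V) := hBW hVB
  exact plaqSmall_of_linkTube (hσ _ hU).2 hVt

end Pers

end Summit.QuantumFields.YangMills.Theorems.FluctuationComparisonRegPrIntLSectionTubeSplit

end
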